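import Mathlib.Analysis.SpecialFunctions.Pow.Real
import HarnessLib

/-!
# RiemannHypothesis / GroundBarta — crux `PolarPerronFrobenius` (stmt-RiemannHypothesis-18390):
# NEGATIVE knowledge — "even wins" does not rescue Perron–Frobenius under a positive rank-one push

Negative-side helper file of the standing disprover (`--supports stmt-RiemannHypothesis-18390`; lane
`Theorems/PolarPerronFrobenius/Negative/`), RH-free, Mathlib only, no definitions, no named facts, no sorry.

The crux's matrix at a window is `EW(a) → GSP(a)`: *if the even sector carries the bottom of the windowed
Weil form `Re Q = 2|⟨·,cosh(t/2)⟩|² + 𝓔_a − M_a‖·‖²` (`𝓔_a` a reflection-symmetric Markovian jump form: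
Perron–Frobenius bottom one-signed and even; the polar push `2|⟨·,c⟩|²` is rank-one, non-negative, along
the POSITIVE EVEN vector `c = cosh(t/2)` and vanishes on the odd sector), then the ground state is
one-signed.*  The companion file `NotPolarPerronFrobenius.lean` (`toy_rankOne_not_oneSigned`) shows in
dimension 2 that the push alone can destroy one-signedness — but there the perturbed bottom is ODD, i.e.
the guard `EW` fails and the matrix holds vacuously.  This file removes that loophole:

`toy_evenWins_not_oneSigned` — a FOUR-dimensional model with every structural feature the route names,
in which **the even sector wins strictly and yet the ground state changes sign**.  Nodes `1,2,3,4`,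
reflection `σ = (1 4)(2 3)`; `M` symmetric, `σ`-invariant, ALL off-diagonal entries `< 0`
(`M₁₂=M₁₃=M₂₄=M₃₄=−1/10`, `M₁₄=M₂₃=−1`, zero diagonal): `e^{−tM}` is positivity improving and the bottom of
`M` is the positive even vector `(1,1,1,1)/2` at `−6/5` (part 1).  Push `c = (1/2,1/2,1/2,1/2)` (positive,
even, CONSTANT — as `cosh(t/2) ≈ 1` on a short window), `H = M + 2ccᵀ = M + J/2`.  Then (part 2) every
`σ`-odd vector has `q_H(x) = ‖x‖²`, (part 3) `q_H ≥ −(4/5)‖x‖²` with equality EXACTLY on the line of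
`v = (1,−1,−1,1)/2` — an EVEN vector with mixed signs — so the even bottom `−4/5` beats the odd bottom `1`
("even wins", strictly, with a gap) while the unique ground state is not one-signed; (part 4) every
entrywise non-negative unit vector has `q_H ≥ −2/5`, bounded away from the bottom.

MORAL (what a proof of the crux must use beyond the named mechanism): here the SECOND even level of `M`
(`−4/5`, vector `v`) lies BELOW its first odd level (`+1`: on the odd sector `q_M = ‖x‖²`); the push lifts
the positive even bottom (`−6/5 → +4/5`) past both and `v` inherits the bottom.  For the Weil window form the numerics give the interlacing `ε_ev,1 < ε_od,1 < ε_ev,2` by factors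
`10³`/`10⁶` (disprover's `Cruxes/PolarPerronFrobenius/Disproof.lean`, F5), so THIS mechanism of failure is
excluded there — but only by an oscillation/interlacing property of `𝓔_a` that positivity preservation,
reflection symmetry and the sign of `c` do not supply.  Refuter
`refuter-cdisprove-stmt-RiemannHypothesis-18390-0` (cdisprove cycle 1).
-/

set_option linter.dupNamespace false

noncomputable section

namespace Summit.RiemannHypothesis.RiemannHypothesis.Theorems.PolarPerronFrobenius.Negative

/-- **Even wins, Perron–Frobenius input intact, positive constant rank-one push — and the ground state
changes sign.**  With `q_M(x) = −(1/5)(x₁x₂+x₁x₃+x₂x₄+x₃x₄) − 2(x₁x₄+x₂x₃)` (the form of the `σ`-symmetric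
`M` with all off-diagonal entries negative) and `q_H = q_M + 2⟨c,x⟩²`, `c = (1/2,1/2,1/2,1/2)`, i.e.
`q_H(x) = ½‖x‖² + (4/5)(x₁x₂+x₁x₃+x₂x₄+x₃x₄) − (x₁x₄+x₂x₃)`:
1. (PF input) `q_M ≥ −(6/5)‖x‖²`, attained at the positive even vector `(1,1,1,1)/2`;
2. (odd sector untouched) `q_H(x) = ‖x‖²` for every `σ`-odd `x` (`x₄ = −x₁`, `x₃ = −x₂`);
3. (even wins, sign-changing bottom) `q_H ≥ −(4/5)‖x‖²`, with equality at the even mixed-sign unit vector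
   `(1,−1,−1,1)/2`, and equality forces `x` onto that line;
4. (no one-signed ground state) every entrywise non-negative `x` has `q_H(x) ≥ −(2/5)‖x‖²`. [folklore] -/
theorem toy_evenWins_not_oneSigned :
    -- 1. Perron–Frobenius input: bottom of `M` is `−6/5`, at the positive even vector
    (∀ x₁ x₂ x₃ x₄ : ℝ, -(6 / 5 : ℝ) * (x₁ ^ 2 + x₂ ^ 2 + x₃ ^ 2 + x₄ ^ 2) ≤
        -(1 / 5) * (x₁ * x₂ + x₁ * x₃ + x₂ * x₄ + x₃ * x₄) - 2 * (x₁ * x₄ + x₂ * x₃)) ∧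
    (-(1 / 5 : ℝ) * ((1 / 2) * (1 / 2) + (1 / 2) * (1 / 2) + (1 / 2) * (1 / 2) + (1 / 2) * (1 / 2)) -
        2 * ((1 / 2) * (1 / 2) + (1 / 2) * (1 / 2)) = -(6 / 5) ∧
      ((1 / 2 : ℝ) ^ 2 + (1 / 2) ^ 2 + (1 / 2) ^ 2 + (1 / 2) ^ 2 = 1)) ∧
    -- 2. the push vanishes on the odd sector: `q_H(x) = ‖x‖²` there
    (∀ x₁ x₂ : ℝ, (1 / 2 : ℝ) * (x₁ ^ 2 + x₂ ^ 2 + (-x₂) ^ 2 + (-x₁) ^ 2) +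
        (4 / 5) * (x₁ * x₂ + x₁ * (-x₂) + x₂ * (-x₁) + (-x₂) * (-x₁)) - (x₁ * (-x₁) + x₂ * (-x₂)) =
        x₁ ^ 2 + x₂ ^ 2 + (-x₂) ^ 2 + (-x₁) ^ 2) ∧
    -- 3. even wins strictly: global bottom `−4/5 < 1`, attained exactly on the line of `(1,−1,−1,1)/2`
    (∀ x₁ x₂ x₃ x₄ : ℝ, -(4 / 5 : ℝ) * (x₁ ^ 2 + x₂ ^ 2 + x₃ ^ 2 + x₄ ^ 2) ≤
        (1 / 2) * (x₁ ^ 2 + x₂ ^ 2 + x₃ ^ 2 + x₄ ^ 2) + (4 / 5) * (x₁ * x₂ + x₁ * x₃ + x₂ * x₄ + x₃ * x₄) -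
          (x₁ * x₄ + x₂ * x₃)) ∧
    ((1 / 2 : ℝ) * ((1 / 2) ^ 2 + (-(1 / 2)) ^ 2 + (-(1 / 2)) ^ 2 + (1 / 2) ^ 2) +
        (4 / 5) * ((1 / 2) * (-(1 / 2)) + (1 / 2) * (-(1 / 2)) + (-(1 / 2)) * (1 / 2) + (-(1 / 2)) * (1 / 2)) -
          ((1 / 2) * (1 / 2) + (-(1 / 2)) * (-(1 / 2))) = -(4 / 5) ∧
      ((1 / 2 : ℝ) ^ 2 + (-(1 / 2)) ^ 2 + (-(1 / 2)) ^ 2 + (1 / 2) ^ 2 = 1)) ∧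
    (∀ x₁ x₂ x₃ x₄ : ℝ,
        (1 / 2 : ℝ) * (x₁ ^ 2 + x₂ ^ 2 + x₃ ^ 2 + x₄ ^ 2) + (4 / 5) * (x₁ * x₂ + x₁ * x₃ + x₂ * x₄ + x₃ * x₄) -
            (x₁ * x₄ + x₂ * x₃) = -(4 / 5) * (x₁ ^ 2 + x₂ ^ 2 + x₃ ^ 2 + x₄ ^ 2) →
          x₄ = x₁ ∧ x₃ = x₂ ∧ x₂ = -x₁) ∧
    -- 4. no non-negative vector comes near the bottom
    (∀ x₁ x₂ x₃ x₄ : ℝ, 0 ≤ x₁ → 0 ≤ x₂ → 0 ≤ x₃ → 0 ≤ x₄ →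
        -(2 / 5 : ℝ) * (x₁ ^ 2 + x₂ ^ 2 + x₃ ^ 2 + x₄ ^ 2) ≤
          (1 / 2) * (x₁ ^ 2 + x₂ ^ 2 + x₃ ^ 2 + x₄ ^ 2) + (4 / 5) * (x₁ * x₂ + x₁ * x₃ + x₂ * x₄ + x₃ * x₄) -
            (x₁ * x₄ + x₂ * x₃)) := by
  refine ⟨fun x₁ x₂ x₃ x₄ ↦ ?_, ⟨by norm_num, by norm_num⟩, fun x₁ x₂ ↦ by ring, fun x₁ x₂ x₃ x₄ ↦ ?_,
    ⟨by norm_num, by norm_num⟩, fun x₁ x₂ x₃ x₄ h ↦ ?_, fun x₁ x₂ x₃ x₄ h₁ h₂ h₃ h₄ ↦ ?_⟩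
  · -- SOS: q_M + (6/5)‖x‖² = (1/10)(x₁−x₂−x₃+x₄)² + (11/10)((x₁−x₄)² + (x₂−x₃)²)
    nlinarith [sq_nonneg (x₁ - x₂ - x₃ + x₄), sq_nonneg (x₁ - x₄), sq_nonneg (x₂ - x₃)]
  · -- SOS: q_H + (4/5)‖x‖² = (2/5)(x₁+x₂+x₃+x₄)² + (9/10)((x₁−x₄)² + (x₂−x₃)²)
    nlinarith [sq_nonneg (x₁ + x₂ + x₃ + x₄), sq_nonneg (x₁ - x₄), sq_nonneg (x₂ - x₃)]
  · have hsos : (2 / 5 : ℝ) * (x₁ + x₂ + x₃ + x₄) ^ 2 + (9 / 10) * ((x₁ - x₄) ^ 2 + (x₂ - x₃) ^ 2) = 0 := by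
      linear_combination h
    have h14 : (x₁ - x₄) ^ 2 = 0 := by
      nlinarith [sq_nonneg (x₁ + x₂ + x₃ + x₄), sq_nonneg (x₁ - x₄), sq_nonneg (x₂ - x₃)]
    have h23 : (x₂ - x₃) ^ 2 = 0 := by
      nlinarith [sq_nonneg (x₁ + x₂ + x₃ + x₄), sq_nonneg (x₁ - x₄), sq_nonneg (x₂ - x₃)]
    have hs : (x₁ + x₂ + x₃ + x₄) ^ 2 = 0 := by
      nlinarith [sq_nonneg (x₁ + x₂ + x₃ + x₄), sq_nonneg (x₁ - x₄), sq_nonneg (x₂ - x₃)]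
    have e14 : x₁ - x₄ = 0 := pow_eq_zero_iff (n := 2) (by norm_num) |>.1 h14
    have e23 : x₂ - x₃ = 0 := pow_eq_zero_iff (n := 2) (by norm_num) |>.1 h23
    have es : x₁ + x₂ + x₃ + x₄ = 0 := pow_eq_zero_iff (n := 2) (by norm_num) |>.1 hs
    exact ⟨by linarith, by linarith, by linarith⟩
  · -- for x ≥ 0: (Σ xᵢ)² ≥ ‖x‖², so q_H ≥ −(4/5)‖x‖² + (2/5)‖x‖²
    nlinarith [sq_nonneg (x₁ - x₄), sq_nonneg (x₂ - x₃), mul_nonneg h₁ h₂, mul_nonneg h₁ h₃,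
      mul_nonneg h₁ h₄, mul_nonneg h₂ h₃, mul_nonneg h₂ h₄, mul_nonneg h₃ h₄]

end Summit.RiemannHypothesis.RiemannHypothesis.Theorems.PolarPerronFrobenius.Negative

end
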